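import Summits.KontsevichZagierPeriods.KontsevichZagierPeriods.Theorems.HurwitzMicroSectorsNormalFormPrincipleM3EbdExistsSimplexReps

/-!
# `NormalFormPrinciple` (stmt-KontsevichZagierPeriods-3869), line `SketchIdeator1` —
# layer `L2W3` (level-2 weight-3 descent): the simplex-side carriers of the four boxes exist

Pure proof file (registered sub-goal `l2w3_exists_chartTargets`, lead seat c9; `--supports` the
crux). The four remaining dimension-three instances of the leaf `stub_boxRigidity` from the crux
idea `m3-equal-value-instances` — FiveEighthsZetaThree, HalfPointZetaThree, HalfPointDuality,
HalfPointZetaTwoLogTwo — start by charting each box `[(0,1)³, R(x,y,z)]` onto the decreasing open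
simplex `Δ = {1 > t₀ > t₁ > t₂ > 0}` along `t = (x, xy, xyz)` (`M3.ebd_box_sub_simplex`, rule 2),
where the integrand becomes `R(t₀, t₁/t₀, t₂/t₁)/(t₀t₁)`. This file supplies the six target
representations on `Δ` as honest `KZ.IntegralRep 3`:

`8/(t₀t₁(1+t₁)(1+t₂))`, `5/(t₀t₁(1−t₂))`, `16/(t₀(2−t₀)t₁(2−t₂))`, `2/(t₀t₁(2−t₁)(2−t₂))`,
`1/(t₀(1+t₀)t₁(1+t₂))`, `4/(t₀(2−t₀)t₁(1−t₂))`.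

Each is a quotient of `ℚ`-polynomials with non-vanishing denominator on `Δ` (semialgebraic), and
each is DOMINATED on `Δ` by a constant multiple of the `ζ(3)` iterated-integral kernel
`G = 1/(t₀t₁(1−t₂))` (since `1/(1+t) ≤ 1`, `1/(2−t) ≤ 1 ≤ 1/(1−t)` on `(0,1)`), which is integrable
on `Δ` (`ebd2_integrableOn_G`, from `KZ.mzvIntegrand_integrableOn_holds [3]`).
Sources: M. Kontsevich, D. Zagier, *Periods* (2001), §1.1. No definitions are introduced.
-/

noncomputable section

open MeasureTheory Set
open Literature.NumberTheory.Transcendental Literature.NumberTheory.Transcendental.KZ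
open Literature.ModelTheory.ExponentialFields (IsSemialgebraic)

namespace Summit.KontsevichZagierPeriods.HurwitzMicroSectors.NormalFormPrinciple.PiBox.M3

/-- Coordinate bounds on the decreasing open simplex: every coordinate lies in `(0,1)`.
[folklore] -/
theorem l2b_mem_Ioo_of_mem_simplex {t : Fin 3 → ℝ}
    (ht : t ∈ {t : Fin 3 → ℝ | 0 < t 2 ∧ t 2 < t 1 ∧ t 1 < t 0 ∧ t 0 < 1}) (i : Fin 3) :
    0 < t i ∧ t i < 1 := by
  obtain ⟨h2, h21, h10, h0⟩ := ht
  match i with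
  | 0 => exact ⟨by linarith, h0⟩
  | 1 => exact ⟨by linarith, by linarith⟩
  | 2 => exact ⟨h2, by linarith⟩

/-- **Domination principle on the simplex.** A function continuous on the decreasing open simplex
`Δ` and dominated there by `C·G`, `G = 1/(t₀t₁(1−t₂))` (the `ζ(3)` kernel, integrable on `Δ` by
`ebd2_integrableOn_G`), is integrable on `Δ`. [cite: KontsevichZagier2001, §1.1] -/
theorem l2b_integrableOn_of_abs_le {f : (Fin 3 → ℝ) → ℝ} (C : ℝ)
    (hf : ContinuousOn f {t : Fin 3 → ℝ | 0 < t 2 ∧ t 2 < t 1 ∧ t 1 < t 0 ∧ t 0 < 1})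
    (hle : ∀ t ∈ {t : Fin 3 → ℝ | 0 < t 2 ∧ t 2 < t 1 ∧ t 1 < t 0 ∧ t 0 < 1},
      |f t| ≤ C * (1 / (t 0 * t 1 * (1 - t 2)))) :
    IntegrableOn f {t : Fin 3 → ℝ | 0 < t 2 ∧ t 2 < t 1 ∧ t 1 < t 0 ∧ t 0 < 1} := by
  refine Integrable.mono' (ebd2_integrableOn_G.const_mul C)
    (hf.aestronglyMeasurable ebd2_measurableSet_simplex)
    (ae_restrict_of_forall_mem ebd2_measurableSet_simplex fun t ht => ?_)
  rw [Real.norm_eq_abs]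
  exact hle t ht

/-- The elementary letter bounds on `(0,1)`: `1/(1+u) ≤ 1`, `1/(2−u) ≤ 1`, `1 ≤ 1/(1−u)`,
`1 ≤ 1/u`. [folklore] -/
theorem l2b_letter_bounds {u : ℝ} (hu0 : 0 < u) (hu1 : u < 1) :
    1 / (1 + u) ≤ 1 ∧ 1 / (2 - u) ≤ 1 ∧ 1 ≤ 1 / (1 - u) ∧ 1 ≤ 1 / u := by
  refine ⟨?_, ?_, ?_, ?_⟩
  · rw [div_le_one (by linarith)]; linarith
  · rw [div_le_one (by linarith)]; linarith
  · rw [le_div_iff₀ (by linarith)]; linarith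
  · rw [le_div_iff₀ hu0]; linarith

/-- **Generic carrier on the simplex.** For rationals `k` and letters encoded by
`pᵢ + qᵢ·t` (`i = 0,1,2`, outer factor) and `p₃ + q₃·t₀` (an optional second factor in `t₀`),
if all four affine forms are positive on the relevant coordinates of `Δ` and the integrand is
dominated by `C·G`, the representation exists. We only need the concrete instances below, so we
state the existence directly for an integrand `f` that is a quotient of `ℚ`-polynomials:
semialgebraic by `isSemialgebraicFunOn_aeval_div_aeval`, integrable by `l2b_integrableOn_of_abs_le`.
[cite: KontsevichZagier2001, §1.1] -/
theorem l2b_exists_of_aeval {p q : MvPolynomial (Fin 3) ℚ} (C : ℝ)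
    (hq : ∀ t ∈ {t : Fin 3 → ℝ | 0 < t 2 ∧ t 2 < t 1 ∧ t 1 < t 0 ∧ t 0 < 1},
      (MvPolynomial.aeval t q : ℝ) ≠ 0)
    (hle : ∀ t ∈ {t : Fin 3 → ℝ | 0 < t 2 ∧ t 2 < t 1 ∧ t 1 < t 0 ∧ t 0 < 1},
      |(MvPolynomial.aeval t p : ℝ) / MvPolynomial.aeval t q| ≤ C * (1 / (t 0 * t 1 * (1 - t 2)))) :
    ∃ T : IntegralRep 3, T.domain = {t | 0 < t 2 ∧ t 2 < t 1 ∧ t 1 < t 0 ∧ t 0 < 1} ∧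
      T.integrand = fun t => (MvPolynomial.aeval t p : ℝ) / MvPolynomial.aeval t q := by
  refine ⟨⟨_, _, ebd2_isSemialgebraic_simplex,
    isSemialgebraicFunOn_aeval_div_aeval ebd2_isSemialgebraic_simplex p q hq,
    l2b_integrableOn_of_abs_le C ?_ hle⟩, rfl, rfl⟩
  exact ContinuousOn.div (Literature.ModelTheory.ExponentialFields.continuous_aeval_real p).continuousOn
    (Literature.ModelTheory.ExponentialFields.continuous_aeval_real q).continuousOn hq

/-- The `ζ(3)` kernel `G = 1/(t₀t₁(1−t₂))` is positive on `Δ`, and a product bound: if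
`0 ≤ n ≤ k` and `d ≥ t₀t₁(1−t₂) > 0` then `n/d ≤ k·G`. [folklore] -/
theorem l2b_div_le_mul_G {t : Fin 3 → ℝ}
    (ht : t ∈ {t : Fin 3 → ℝ | 0 < t 2 ∧ t 2 < t 1 ∧ t 1 < t 0 ∧ t 0 < 1})
    {n k d : ℝ} (hn : 0 ≤ n) (hnk : n ≤ k) (hd : t 0 * t 1 * (1 - t 2) ≤ d) :
    |n / d| ≤ k * (1 / (t 0 * t 1 * (1 - t 2))) := by
  obtain ⟨h0, h1, -, h2⟩ := ebd2_pos_of_mem_simplex ht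
  have hG : 0 < t 0 * t 1 * (1 - t 2) := mul_pos (mul_pos h0 h1) h2
  have hdpos : 0 < d := hG.trans_le hd
  rw [abs_of_nonneg (div_nonneg hn hdpos.le), mul_one_div]
  exact div_le_div₀ (hn.trans hnk) hnk hG hd

/-! ## The six carriers -/

/-- `[Δ, 8/(t₀t₁(1+t₁)(1+t₂))]` exists (FiveEighthsZetaThree, left side; dominated by `8G`).
[cite: KontsevichZagier2001, §1.1] -/
theorem l2b_exists_T1 :
    ∃ T : IntegralRep 3, T.domain = {t | 0 < t 2 ∧ t 2 < t 1 ∧ t 1 < t 0 ∧ t 0 < 1} ∧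
      T.integrand = fun t => 8 / (t 0 * t 1 * (1 + t 1) * (1 + t 2)) := by
  have hq : ∀ t ∈ {t : Fin 3 → ℝ | 0 < t 2 ∧ t 2 < t 1 ∧ t 1 < t 0 ∧ t 0 < 1},
      (MvPolynomial.aeval t (MvPolynomial.X 0 * MvPolynomial.X 1 * (1 + MvPolynomial.X 1) * (1 + MvPolynomial.X 2) : MvPolynomial (Fin 3) ℚ) : ℝ) ≠ 0 := by
    intro t ht
    obtain ⟨h0, h1, -, -⟩ := ebd2_pos_of_mem_simplex ht
    have h1' : 0 < 1 + t 1 := by linarith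
    have h2' : 0 < 1 + t 2 := by linarith [(l2b_mem_Ioo_of_mem_simplex ht 2).1]
    simp only [map_mul, map_add, map_one, MvPolynomial.aeval_X]
    positivity
  have hle : ∀ t ∈ {t : Fin 3 → ℝ | 0 < t 2 ∧ t 2 < t 1 ∧ t 1 < t 0 ∧ t 0 < 1},
      |(MvPolynomial.aeval t (8 : MvPolynomial (Fin 3) ℚ) : ℝ) /
        MvPolynomial.aeval t (MvPolynomial.X 0 * MvPolynomial.X 1 * (1 + MvPolynomial.X 1) * (1 + MvPolynomial.X 2) : MvPolynomial (Fin 3) ℚ)|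
        ≤ 8 * (1 / (t 0 * t 1 * (1 - t 2))) := by
    intro t ht
    obtain ⟨h0, h1, -, h2⟩ := ebd2_pos_of_mem_simplex ht
    have ht1 := l2b_mem_Ioo_of_mem_simplex ht 1
    have ht2 := l2b_mem_Ioo_of_mem_simplex ht 2
    simp only [map_ofNat, map_mul, map_add, map_one, MvPolynomial.aeval_X]
    refine l2b_div_le_mul_G ht (by norm_num) le_rfl ?_
    -- `t₀t₁(1−t₂) ≤ t₀t₁(1+t₁)(1+t₂)`
    have h01 : 0 < t 0 * t 1 := mul_pos h0 h1
    nlinarith [mul_pos h01 ht1.1, mul_pos h01 ht2.1, mul_pos (mul_pos h01 ht1.1) ht2.1]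
  obtain ⟨T, hTd, hTi⟩ := l2b_exists_of_aeval 8 hq hle
  exact ⟨T, hTd, hTi.trans (funext fun t => by
    simp only [map_ofNat, map_mul, map_add, map_one, MvPolynomial.aeval_X])⟩

/-- `[Δ, 5/(t₀t₁(1−t₂))]` exists (the common right side `5·ζ(3)`). [cite: KontsevichZagier2001, §1.1] -/
theorem l2b_exists_T2 :
    ∃ T : IntegralRep 3, T.domain = {t | 0 < t 2 ∧ t 2 < t 1 ∧ t 1 < t 0 ∧ t 0 < 1} ∧
      T.integrand = fun t => 5 / (t 0 * t 1 * (1 - t 2)) := by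
  have hq : ∀ t ∈ {t : Fin 3 → ℝ | 0 < t 2 ∧ t 2 < t 1 ∧ t 1 < t 0 ∧ t 0 < 1},
      (MvPolynomial.aeval t (MvPolynomial.X 0 * MvPolynomial.X 1 * (1 - MvPolynomial.X 2) : MvPolynomial (Fin 3) ℚ) : ℝ) ≠ 0 := by
    intro t ht
    obtain ⟨h0, h1, -, h2⟩ := ebd2_pos_of_mem_simplex ht
    simp only [map_mul, map_sub, map_one, MvPolynomial.aeval_X]
    positivity
  have hle : ∀ t ∈ {t : Fin 3 → ℝ | 0 < t 2 ∧ t 2 < t 1 ∧ t 1 < t 0 ∧ t 0 < 1},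
      |(MvPolynomial.aeval t (5 : MvPolynomial (Fin 3) ℚ) : ℝ) /
        MvPolynomial.aeval t (MvPolynomial.X 0 * MvPolynomial.X 1 * (1 - MvPolynomial.X 2) : MvPolynomial (Fin 3) ℚ)|
        ≤ 5 * (1 / (t 0 * t 1 * (1 - t 2))) := by
    intro t ht
    simp only [map_ofNat, map_mul, map_sub, map_one, MvPolynomial.aeval_X]
    exact l2b_div_le_mul_G ht (by norm_num) le_rfl le_rfl
  obtain ⟨T, hTd, hTi⟩ := l2b_exists_of_aeval 5 hq hle
  exact ⟨T, hTd, hTi.trans (funext fun t => by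
    simp only [map_ofNat, map_mul, map_sub, map_one, MvPolynomial.aeval_X])⟩

/-- `[Δ, 16/(t₀(2−t₀)t₁(2−t₂))]` exists (HalfPointZetaThree, left side; dominated by `16G`).
[cite: KontsevichZagier2001, §1.1] -/
theorem l2b_exists_T3 :
    ∃ T : IntegralRep 3, T.domain = {t | 0 < t 2 ∧ t 2 < t 1 ∧ t 1 < t 0 ∧ t 0 < 1} ∧
      T.integrand = fun t => 16 / (t 0 * (2 - t 0) * t 1 * (2 - t 2)) := by
  have hq : ∀ t ∈ {t : Fin 3 → ℝ | 0 < t 2 ∧ t 2 < t 1 ∧ t 1 < t 0 ∧ t 0 < 1},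
      (MvPolynomial.aeval t (MvPolynomial.X 0 * (2 - MvPolynomial.X 0) * MvPolynomial.X 1 * (2 - MvPolynomial.X 2) : MvPolynomial (Fin 3) ℚ) : ℝ) ≠ 0 := by
    intro t ht
    have ht0 := l2b_mem_Ioo_of_mem_simplex ht 0
    have ht1 := l2b_mem_Ioo_of_mem_simplex ht 1
    have ht2 := l2b_mem_Ioo_of_mem_simplex ht 2
    have h0' : 0 < 2 - t 0 := by linarith [ht0.2]
    have h2' : 0 < 2 - t 2 := by linarith [ht2.2]
    have := ht0.1; have := ht1.1
    simp only [map_ofNat, map_mul, map_sub, MvPolynomial.aeval_X]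
    positivity
  have hle : ∀ t ∈ {t : Fin 3 → ℝ | 0 < t 2 ∧ t 2 < t 1 ∧ t 1 < t 0 ∧ t 0 < 1},
      |(MvPolynomial.aeval t (16 : MvPolynomial (Fin 3) ℚ) : ℝ) /
        MvPolynomial.aeval t (MvPolynomial.X 0 * (2 - MvPolynomial.X 0) * MvPolynomial.X 1 * (2 - MvPolynomial.X 2) : MvPolynomial (Fin 3) ℚ)|
        ≤ 16 * (1 / (t 0 * t 1 * (1 - t 2))) := by
    intro t ht
    have ht0 := l2b_mem_Ioo_of_mem_simplex ht 0
    have ht1 := l2b_mem_Ioo_of_mem_simplex ht 1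
    have ht2 := l2b_mem_Ioo_of_mem_simplex ht 2
    simp only [map_ofNat, map_mul, map_sub, MvPolynomial.aeval_X]
    refine l2b_div_le_mul_G ht (by norm_num) le_rfl ?_
    -- `t₀t₁(1−t₂) ≤ t₀(2−t₀)t₁(2−t₂)` since `1 ≤ 2−t₀` and `1−t₂ ≤ 2−t₂`
    have h01 : 0 < t 0 * t 1 := mul_pos ht0.1 ht1.1
    nlinarith [mul_pos h01 (sub_pos.2 ht0.2), mul_pos h01 (sub_pos.2 ht2.2),
      mul_pos (mul_pos h01 (sub_pos.2 ht0.2)) (sub_pos.2 ht2.2), h01]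
  obtain ⟨T, hTd, hTi⟩ := l2b_exists_of_aeval 16 hq hle
  exact ⟨T, hTd, hTi.trans (funext fun t => by
    simp only [map_ofNat, map_mul, map_sub, MvPolynomial.aeval_X])⟩

/-- `[Δ, 2/(t₀t₁(2−t₁)(2−t₂))]` exists (HalfPointDuality, left side; dominated by `2G`).
[cite: KontsevichZagier2001, §1.1] -/
theorem l2b_exists_T4 :
    ∃ T : IntegralRep 3, T.domain = {t | 0 < t 2 ∧ t 2 < t 1 ∧ t 1 < t 0 ∧ t 0 < 1} ∧
      T.integrand = fun t => 2 / (t 0 * t 1 * (2 - t 1) * (2 - t 2)) := by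
  have hq : ∀ t ∈ {t : Fin 3 → ℝ | 0 < t 2 ∧ t 2 < t 1 ∧ t 1 < t 0 ∧ t 0 < 1},
      (MvPolynomial.aeval t (MvPolynomial.X 0 * MvPolynomial.X 1 * (2 - MvPolynomial.X 1) * (2 - MvPolynomial.X 2) : MvPolynomial (Fin 3) ℚ) : ℝ) ≠ 0 := by
    intro t ht
    have ht0 := l2b_mem_Ioo_of_mem_simplex ht 0
    have ht1 := l2b_mem_Ioo_of_mem_simplex ht 1
    have ht2 := l2b_mem_Ioo_of_mem_simplex ht 2
    have h1' : 0 < 2 - t 1 := by linarith [ht1.2]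
    have h2' : 0 < 2 - t 2 := by linarith [ht2.2]
    have := ht0.1; have := ht1.1
    simp only [map_ofNat, map_mul, map_sub, MvPolynomial.aeval_X]
    positivity
  have hle : ∀ t ∈ {t : Fin 3 → ℝ | 0 < t 2 ∧ t 2 < t 1 ∧ t 1 < t 0 ∧ t 0 < 1},
      |(MvPolynomial.aeval t (2 : MvPolynomial (Fin 3) ℚ) : ℝ) /
        MvPolynomial.aeval t (MvPolynomial.X 0 * MvPolynomial.X 1 * (2 - MvPolynomial.X 1) * (2 - MvPolynomial.X 2) : MvPolynomial (Fin 3) ℚ)|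
        ≤ 2 * (1 / (t 0 * t 1 * (1 - t 2))) := by
    intro t ht
    have ht0 := l2b_mem_Ioo_of_mem_simplex ht 0
    have ht1 := l2b_mem_Ioo_of_mem_simplex ht 1
    have ht2 := l2b_mem_Ioo_of_mem_simplex ht 2
    simp only [map_ofNat, map_mul, map_sub, MvPolynomial.aeval_X]
    refine l2b_div_le_mul_G ht (by norm_num) le_rfl ?_
    have h01 : 0 < t 0 * t 1 := mul_pos ht0.1 ht1.1
    nlinarith [mul_pos h01 (sub_pos.2 ht1.2), mul_pos h01 (sub_pos.2 ht2.2),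
      mul_pos (mul_pos h01 (sub_pos.2 ht1.2)) (sub_pos.2 ht2.2), h01]
  obtain ⟨T, hTd, hTi⟩ := l2b_exists_of_aeval 2 hq hle
  exact ⟨T, hTd, hTi.trans (funext fun t => by
    simp only [map_ofNat, map_mul, map_sub, MvPolynomial.aeval_X])⟩

/-- `[Δ, 1/(t₀(1+t₀)t₁(1+t₂))]` exists (HalfPointDuality, right side; dominated by `G`).
[cite: KontsevichZagier2001, §1.1] -/
theorem l2b_exists_T5 :
    ∃ T : IntegralRep 3, T.domain = {t | 0 < t 2 ∧ t 2 < t 1 ∧ t 1 < t 0 ∧ t 0 < 1} ∧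
      T.integrand = fun t => 1 / (t 0 * (1 + t 0) * t 1 * (1 + t 2)) := by
  have hq : ∀ t ∈ {t : Fin 3 → ℝ | 0 < t 2 ∧ t 2 < t 1 ∧ t 1 < t 0 ∧ t 0 < 1},
      (MvPolynomial.aeval t (MvPolynomial.X 0 * (1 + MvPolynomial.X 0) * MvPolynomial.X 1 * (1 + MvPolynomial.X 2) : MvPolynomial (Fin 3) ℚ) : ℝ) ≠ 0 := by
    intro t ht
    have ht0 := l2b_mem_Ioo_of_mem_simplex ht 0
    have ht1 := l2b_mem_Ioo_of_mem_simplex ht 1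
    have ht2 := l2b_mem_Ioo_of_mem_simplex ht 2
    have h0' : 0 < 1 + t 0 := by linarith [ht0.1]
    have h2' : 0 < 1 + t 2 := by linarith [ht2.1]
    have := ht0.1; have := ht1.1
    simp only [map_one, map_mul, map_add, MvPolynomial.aeval_X]
    positivity
  have hle : ∀ t ∈ {t : Fin 3 → ℝ | 0 < t 2 ∧ t 2 < t 1 ∧ t 1 < t 0 ∧ t 0 < 1},
      |(MvPolynomial.aeval t (1 : MvPolynomial (Fin 3) ℚ) : ℝ) /
        MvPolynomial.aeval t (MvPolynomial.X 0 * (1 + MvPolynomial.X 0) * MvPolynomial.X 1 * (1 + MvPolynomial.X 2) : MvPolynomial (Fin 3) ℚ)|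
        ≤ 1 * (1 / (t 0 * t 1 * (1 - t 2))) := by
    intro t ht
    have ht0 := l2b_mem_Ioo_of_mem_simplex ht 0
    have ht1 := l2b_mem_Ioo_of_mem_simplex ht 1
    have ht2 := l2b_mem_Ioo_of_mem_simplex ht 2
    simp only [map_one, map_mul, map_add, MvPolynomial.aeval_X]
    refine l2b_div_le_mul_G ht (by norm_num) le_rfl ?_
    have h01 : 0 < t 0 * t 1 := mul_pos ht0.1 ht1.1
    nlinarith [mul_pos h01 ht0.1, mul_pos h01 ht2.1, mul_pos (mul_pos h01 ht0.1) ht2.1, h01,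
      mul_pos h01 (sub_pos.2 ht2.2)]
  obtain ⟨T, hTd, hTi⟩ := l2b_exists_of_aeval 1 hq hle
  exact ⟨T, hTd, hTi.trans (funext fun t => by
    simp only [map_one, map_mul, map_add, MvPolynomial.aeval_X])⟩

/-- `[Δ, 4/(t₀(2−t₀)t₁(1−t₂))]` exists (HalfPointZetaTwoLogTwo, left side; dominated by `4G`).
[cite: KontsevichZagier2001, §1.1] -/
theorem l2b_exists_T6 :
    ∃ T : IntegralRep 3, T.domain = {t | 0 < t 2 ∧ t 2 < t 1 ∧ t 1 < t 0 ∧ t 0 < 1} ∧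
      T.integrand = fun t => 4 / (t 0 * (2 - t 0) * t 1 * (1 - t 2)) := by
  have hq : ∀ t ∈ {t : Fin 3 → ℝ | 0 < t 2 ∧ t 2 < t 1 ∧ t 1 < t 0 ∧ t 0 < 1},
      (MvPolynomial.aeval t (MvPolynomial.X 0 * (2 - MvPolynomial.X 0) * MvPolynomial.X 1 * (1 - MvPolynomial.X 2) : MvPolynomial (Fin 3) ℚ) : ℝ) ≠ 0 := by
    intro t ht
    have ht0 := l2b_mem_Ioo_of_mem_simplex ht 0
    have ht1 := l2b_mem_Ioo_of_mem_simplex ht 1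
    have ht2 := l2b_mem_Ioo_of_mem_simplex ht 2
    have h0' : 0 < 2 - t 0 := by linarith [ht0.2]
    have h2' : 0 < 1 - t 2 := by linarith [ht2.2]
    have := ht0.1; have := ht1.1
    simp only [map_ofNat, map_mul, map_sub, map_one, MvPolynomial.aeval_X]
    positivity
  have hle : ∀ t ∈ {t : Fin 3 → ℝ | 0 < t 2 ∧ t 2 < t 1 ∧ t 1 < t 0 ∧ t 0 < 1},
      |(MvPolynomial.aeval t (4 : MvPolynomial (Fin 3) ℚ) : ℝ) /
        MvPolynomial.aeval t (MvPolynomial.X 0 * (2 - MvPolynomial.X 0) * MvPolynomial.X 1 * (1 - MvPolynomial.X 2) : MvPolynomial (Fin 3) ℚ)|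
        ≤ 4 * (1 / (t 0 * t 1 * (1 - t 2))) := by
    intro t ht
    have ht0 := l2b_mem_Ioo_of_mem_simplex ht 0
    have ht1 := l2b_mem_Ioo_of_mem_simplex ht 1
    have ht2 := l2b_mem_Ioo_of_mem_simplex ht 2
    simp only [map_ofNat, map_mul, map_sub, map_one, MvPolynomial.aeval_X]
    refine l2b_div_le_mul_G ht (by norm_num) le_rfl ?_
    have h01 : 0 < t 0 * t 1 := mul_pos ht0.1 ht1.1
    nlinarith [mul_pos h01 (sub_pos.2 ht0.2), mul_pos (mul_pos h01 (sub_pos.2 ht0.2)) (sub_pos.2 ht2.2),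
      mul_pos h01 (sub_pos.2 ht2.2), h01]
  obtain ⟨T, hTd, hTi⟩ := l2b_exists_of_aeval 4 hq hle
  exact ⟨T, hTd, hTi.trans (funext fun t => by
    simp only [map_ofNat, map_mul, map_sub, map_one, MvPolynomial.aeval_X])⟩

/-! ## The registered sub-goal -/

/-- **Stub L1b (`l2w3_exists_chartTargets`; registered sub-goal of stmt-KontsevichZagierPeriods-3869,
line `SketchIdeator1`, layer `L2W3`).** The six simplex-side carriers of the four box pairs of the
level-2 weight-3 descent exist as integral representations on the decreasing open simplex with
literally the displayed integrands. [cite: KontsevichZagier2001, §1.1] -/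
theorem l2w3_exists_chartTargets :
    (∃ T : IntegralRep 3, T.domain = {t | 0 < t 2 ∧ t 2 < t 1 ∧ t 1 < t 0 ∧ t 0 < 1} ∧
      T.integrand = fun t => 8 / (t 0 * t 1 * (1 + t 1) * (1 + t 2))) ∧
    (∃ T : IntegralRep 3, T.domain = {t | 0 < t 2 ∧ t 2 < t 1 ∧ t 1 < t 0 ∧ t 0 < 1} ∧
      T.integrand = fun t => 5 / (t 0 * t 1 * (1 - t 2))) ∧
    (∃ T : IntegralRep 3, T.domain = {t | 0 < t 2 ∧ t 2 < t 1 ∧ t 1 < t 0 ∧ t 0 < 1} ∧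
      T.integrand = fun t => 16 / (t 0 * (2 - t 0) * t 1 * (2 - t 2))) ∧
    (∃ T : IntegralRep 3, T.domain = {t | 0 < t 2 ∧ t 2 < t 1 ∧ t 1 < t 0 ∧ t 0 < 1} ∧
      T.integrand = fun t => 2 / (t 0 * t 1 * (2 - t 1) * (2 - t 2))) ∧
    (∃ T : IntegralRep 3, T.domain = {t | 0 < t 2 ∧ t 2 < t 1 ∧ t 1 < t 0 ∧ t 0 < 1} ∧
      T.integrand = fun t => 1 / (t 0 * (1 + t 0) * t 1 * (1 + t 2))) ∧
    (∃ T : IntegralRep 3, T.domain = {t | 0 < t 2 ∧ t 2 < t 1 ∧ t 1 < t 0 ∧ t 0 < 1} ∧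
      T.integrand = fun t => 4 / (t 0 * (2 - t 0) * t 1 * (1 - t 2))) :=
  ⟨l2b_exists_T1, l2b_exists_T2, l2b_exists_T3, l2b_exists_T4, l2b_exists_T5, l2b_exists_T6⟩

end Summit.KontsevichZagierPeriods.HurwitzMicroSectors.NormalFormPrinciple.PiBox.M3
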